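import Literature.Probability.LatticeModels.GaussianPrecisionReflectionPositivity
import Literature.Probability.LatticeModels.GaussianFieldReflectionPositivityVector
import HarnessLib

/-!
# Reflection positivity of a Gaussian lattice field from its precision, II: reflections THROUGH sites (a fixed hyperplane)

Theorem-only file (no definitions, no named facts).  `GaussianPrecisionReflectionPositivity` treats an involution `θ` swapping the half `P` with its
complement (reflection in a hyperplane BETWEEN lattice sites).  Fröhlich–Israel–Lieb–Simon (§2) and Biskup (§5.1, `𝕋_L^±` with `𝕋_L^+ ∩ 𝕋_L^- = P` the
fixed hyperplane) also use reflections THROUGH sites: `θ` fixes a hyperplane `F` pointwise and swaps the two open half-spaces; the positive half `P ⊇ F` now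
meets its mirror image in `F`.  For a Gaussian weight `exp(−½⟨φ,Aφ⟩)` with a NEAREST-NEIGHBOUR precision no bond joins the two open half-spaces, and
reflection positivity is the Markov property (FILS Thm. 2.1 with `B` depending on the hyperplane variables; Glimm–Jaffe §7.10 Thm. 7.10.3, lattice form).

THIS FILE proves the finite-dimensional criterion covering BOTH cases: `A` real positive definite and `θ`-invariant, `θ` an involution, `P ⊆ V` with
`θ(V ∖ P) ⊆ P` (the two halves cover `V`) and `P ∩ θP ⊆ Fix θ` (they overlap only in fixed points).  IF the coupling across the cut between the OPEN halves is
ferromagnetic — `Σ_{x,y} w_x A(x,θy) w_y ≤ 0` for every `w` supported in `P ∖ Fix θ` — THEN `0 ≤ Σ_{x,y} u_x A⁻¹(x,θy) u_y` for every `u` supported in `P`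
(★★★ `reflectedCovariance_nonneg_of_precision_sites`; for through-site reflections of a nearest-neighbour precision the hypothesis is `0 ≤ 0`).  PROOF: the even∕odd
split of part I verbatim, with `w = 𝟙_{P∖Fix} Cu₋` (the `θ`-odd vector `Cu₋` vanishes on `Fix θ`).  Consequences: the family form, ★★★
`gaussianField_isReflectionPositive_of_precision_sites` (`N(0,A⁻¹)` is reflection positive on ALL bounded observables measurable in the coordinates in `P`),
the real form, and `cut_nonpos_of_noCoupling` (the cut hypothesis from `A(x,θy) = 0`, `x ≠ y`, and `A(x,θx) ≤ 0` on `P ∖ Fix θ`).  Finally the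
CONVERSE for swapped halves (★★ `precisionCut_nonpos_of_reflectedCovariance_nonneg`, by the sign twist `S A⁻¹ S`, `S = diag(𝟙_P − 𝟙_{Pᶜ})`) makes part I's criterion an
EQUIVALENCE (★★ `reflectedCovariance_nonneg_iff_precisionCut_nonpos`; Glimm–Jaffe §7.10 Remark 3 «equivalent to `C_D ≤ C_N`», lattice form).

## References

* J. Glimm, A. Jaffe, *Quantum Physics. A Functional Integral Point of View* (2nd ed., Springer 1987), §7.10 Def. 7.10.2, Thm. 7.10.1 (proof), Thm. 7.10.3. [GlimmJaffe1987]
* J. Fröhlich, R. Israel, E. H. Lieb, B. Simon, Comm. Math. Phys. 62 (1978) 1–34, §2 (reflections through and between sites), Thm. 2.1. [FILS1978]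
* M. Biskup, LNM 1970 (2009), §5.1 Def. 5.2 (`𝕋_L^+ ∩ 𝕋_L^- = P`), Lemma 5.6. [Biskup2009]
-/

noncomputable section

open Finset Matrix
open scoped BigOperators

universe u

namespace Literature.Probability.LatticeModels

open Literature.MathematicalPhysics.QuantumFieldTheory (IsPosSemidefKernel gaussianFieldOfKernel)

section PrecisionRPSites

variable {V : Type u} [Fintype V]

/-- ★★★ **REFLECTION POSITIVITY OF THE COVARIANCE FROM THE PRECISION, WITH A FIXED HYPERPLANE** (Glimm–Jaffe §7.10 lattice form; FILS Thm. 2.1): `A` real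
positive definite and `θ`-invariant, `θ` an involution, `θ(V ∖ P) ⊆ P`, `P ∩ θP ⊆ Fix θ`; if `Σ_{x,y} w_x A(x,θy) w_y ≤ 0` for every `w` supported in `P ∖ Fix θ`,
then `0 ≤ Σ_{x,y} u_x A⁻¹(x,θy) u_y` for every `u` supported in `P`. [cite: GlimmJaffe1987, §7.10 Def. 7.10.2, Thm. 7.10.1 (proof), Thm. 7.10.3] [cite: FILS1978, §2, Thm. 2.1] -/
theorem reflectedCovariance_nonneg_of_precision_sites [DecidableEq V] {A : Matrix V V ℝ} (hA : A.PosDef) {θ : V ≃ V} (hθ : Function.Involutive θ)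
    (hθA : ∀ x y, A (θ x) (θ y) = A x y) {P : Set V} (hP : ∀ x, x ∉ P → θ x ∈ P) (hF : ∀ x, x ∈ P → θ x ∈ P → θ x = x)
    (hcut : ∀ w : V → ℝ, (∀ x, x ∉ P → w x = 0) → (∀ x, θ x = x → w x = 0) → ∑ x, ∑ y, w x * A x (θ y) * w y ≤ 0)
    (u : V → ℝ) (hu : ∀ x, x ∉ P → u x = 0) :
    0 ≤ ∑ x, ∑ y, u x * A⁻¹ x (θ y) * u y := by
  classical
  have hAt : Aᵀ = A := by
    have h : Aᴴ = A := hA.isHermitian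
    rwa [Matrix.conjTranspose_eq_transpose_of_trivial] at h
  have hdet : IsUnit A.det := (Matrix.isUnit_iff_isUnit_det _).mp hA.isUnit
  set C : Matrix V V ℝ := A⁻¹ with hCdef
  have hCt : Cᵀ = C := by rw [hCdef, Matrix.transpose_nonsing_inv, hAt]
  have hθC : ∀ x y, C (θ x) (θ y) = C x y := inv_apply_equiv_of_invariant θ hθA
  -- the involution on vectors
  let R : (V → ℝ) → (V → ℝ) := fun a x => a (θ x)
  have hR : ∀ a x, R a x = a (θ x) := fun a x => rfl
  have hRR : ∀ a, R (R a) = a := fun a => funext fun x => by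
    show a (θ (θ x)) = a x
    rw [hθ x]
  have hdotRR : ∀ a b, R a ⬝ᵥ R b = a ⬝ᵥ b := fun a b => by
    simp only [dotProduct, hR]
    exact Equiv.sum_comp θ (fun x => a x * b x)
  have hdotR : ∀ a b, R a ⬝ᵥ b = a ⬝ᵥ R b := fun a b => by rw [← hdotRR (R a) b, hRR]
  have hCR : ∀ a, C *ᵥ R a = R (C *ᵥ a) := fun a => mulVec_comp_equiv_eq hθ hθC a
  have hformAR : ∀ a b, R a ⬝ᵥ (A *ᵥ R b) = a ⬝ᵥ (A *ᵥ b) := fun a b => dotProduct_mulVec_comp_equiv hθ hθA a b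
  have hformCR : ∀ a b, R a ⬝ᵥ (C *ᵥ R b) = a ⬝ᵥ (C *ᵥ b) := fun a b => dotProduct_mulVec_comp_equiv hθ hθC a b
  have hsymA : ∀ p q, p ⬝ᵥ (A *ᵥ q) = q ⬝ᵥ (A *ᵥ p) := fun p q => by
    rw [Matrix.dotProduct_mulVec, ← Matrix.mulVec_transpose, hAt, dotProduct_comm]
  have hsymC : ∀ p q, p ⬝ᵥ (C *ᵥ q) = q ⬝ᵥ (C *ᵥ p) := fun p q => by
    rw [Matrix.dotProduct_mulVec, ← Matrix.mulVec_transpose, hCt, dotProduct_comm]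
  -- the target as a form
  rw [reflectedForm_eq_dotProduct C hθ u u]
  change 0 ≤ u ⬝ᵥ (C *ᵥ R u)
  -- even / odd parts
  set up : V → ℝ := u + R u with hup
  set um : V → ℝ := u - R u with hum
  have hRum : R um = -um := by
    funext x
    simp only [hum, hR, Pi.sub_apply, Pi.neg_apply, hθ x]
    ring
  have hG : up ⬝ᵥ (C *ᵥ up) - um ⬝ᵥ (C *ᵥ um) = 4 * (u ⬝ᵥ (C *ᵥ R u)) := by
    have e1 : R u ⬝ᵥ (C *ᵥ R u) = u ⬝ᵥ (C *ᵥ u) := hformCR u u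
    have e2 : R u ⬝ᵥ (C *ᵥ u) = u ⬝ᵥ (C *ᵥ R u) := by rw [hsymC]
    simp only [hup, hum, Matrix.mulVec_add, Matrix.mulVec_sub, add_dotProduct, sub_dotProduct, dotProduct_add,
      dotProduct_sub, e1, e2]
    ring
  -- it suffices to compare the even and odd forms
  suffices hmain : um ⬝ᵥ (C *ᵥ um) ≤ up ⬝ᵥ (C *ᵥ up) by linarith
  -- `v = C u₋` is θ-odd; `w = 𝟙_P v`; `v = w − Rw`; `ṽ = w + Rw`
  set v : V → ℝ := C *ᵥ um with hv
  have hRv : R v = -v := by rw [hv, ← hCR, hRum, Matrix.mulVec_neg]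
  have hvx : ∀ x, v x = -v (θ x) := fun x => by
    have := congr_fun hRv x
    rw [hR, Pi.neg_apply] at this
    linarith
  have hvfix : ∀ x, θ x = x → v x = 0 := fun x hx => by
    have := hvx x
    rw [hx] at this
    linarith
  -- `w = 𝟙_{P ∖ Fix} v`
  set w : V → ℝ := fun x => if x ∈ P ∧ θ x ≠ x then v x else 0 with hw
  have hw_off : ∀ x, x ∉ P → w x = 0 := fun x hx => by simp only [hw, hx, false_and, if_false]
  have hw_fix : ∀ x, θ x = x → w x = 0 := fun x hx => by simp only [hw, hx, ne_eq, not_true_eq_false, and_false, if_false]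
  have hw_θ : ∀ x, x ∈ P → w (θ x) = 0 := fun x hx => by
    by_cases hθx : θ x ∈ P
    · have e := hF x hx hθx
      exact hw_fix (θ x) (by rw [e, e])
    · exact hw_off (θ x) hθx
  have hvw : v = w - R w := by
    funext x
    show v x = w x - w (θ x)
    by_cases hx : x ∈ P
    · rw [hw_θ x hx, sub_zero]
      by_cases hfx : θ x = x
      · rw [hw_fix x hfx, hvfix x hfx]
      · simp only [hw, hx, hfx, ne_eq, not_false_eq_true, and_self, if_true]
    · have hθx : θ x ∈ P := hP x hx
      have hnf : θ (θ x) ≠ θ x := by rw [hθ x]; exact fun h => hx (h ▸ hθx)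
      have hwθ : w (θ x) = v (θ x) := by simp only [hw, hθx, hnf, ne_eq, not_false_eq_true, and_self, if_true]
      rw [hw_off x hx, hwθ, zero_sub, hvx x]
  set vt : V → ℝ := w + R w with hvt
  -- Claim 1: `⟨u₊, ṽ⟩ = ⟨u₋, v⟩ (= 2⟨u, w⟩)`
  have huRw : u ⬝ᵥ R w = 0 := by
    simp only [dotProduct]
    refine Finset.sum_eq_zero fun x _ => ?_
    show u x * w (θ x) = 0
    by_cases hx : x ∈ P
    · rw [hw_θ x hx, mul_zero]
    · rw [hu x hx, zero_mul]
  have hRuw : R u ⬝ᵥ w = 0 := by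
    rw [hdotR]
    exact huRw
  have hclaim1 : up ⬝ᵥ vt = um ⬝ᵥ v := by
    rw [hvw]
    simp only [hup, hum, hvt, add_dotProduct, sub_dotProduct, dotProduct_add, dotProduct_sub, huRw, hRuw, hdotRR]
    ring
  -- Claim 2: `⟨ṽ, Aṽ⟩ − ⟨v, Av⟩ = 4⟨w, A Rw⟩ ≤ 0`
  have hcutw : w ⬝ᵥ (A *ᵥ R w) ≤ 0 := by
    have h := hcut w hw_off hw_fix
    rwa [reflectedForm_eq_dotProduct A hθ w w] at h
  have hvtA : vt ⬝ᵥ (A *ᵥ vt) = 2 * (w ⬝ᵥ (A *ᵥ w)) + 2 * (w ⬝ᵥ (A *ᵥ R w)) := by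
    have e1 : R w ⬝ᵥ (A *ᵥ R w) = w ⬝ᵥ (A *ᵥ w) := hformAR w w
    have e2 : R w ⬝ᵥ (A *ᵥ w) = w ⬝ᵥ (A *ᵥ R w) := by rw [hsymA]
    simp only [hvt, Matrix.mulVec_add, add_dotProduct, dotProduct_add, e1, e2]
    ring
  have hvA : v ⬝ᵥ (A *ᵥ v) = 2 * (w ⬝ᵥ (A *ᵥ w)) - 2 * (w ⬝ᵥ (A *ᵥ R w)) := by
    have e1 : R w ⬝ᵥ (A *ᵥ R w) = w ⬝ᵥ (A *ᵥ w) := hformAR w w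
    have e2 : R w ⬝ᵥ (A *ᵥ w) = w ⬝ᵥ (A *ᵥ R w) := by rw [hsymA]
    rw [hvw]
    simp only [Matrix.mulVec_sub, sub_dotProduct, dotProduct_sub, e1, e2]
    ring
  -- `⟨u₋, Cu₋⟩ = ⟨u₋, v⟩ = 2⟨u₋,v⟩ − ⟨v,Av⟩`
  have humC : um ⬝ᵥ (C *ᵥ um) = um ⬝ᵥ v := by rw [hv]
  have hvAv : v ⬝ᵥ (A *ᵥ v) = um ⬝ᵥ v := by
    have : A *ᵥ v = um := by
      rw [hv, Matrix.mulVec_mulVec, hCdef, Matrix.mul_nonsing_inv _ hdet, Matrix.one_mulVec]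
    rw [this, dotProduct_comm]
  -- the variational inequality at `a = u₊`, `v = ṽ`
  have hVI := two_mul_dotProduct_sub_le_dotProduct_inv_mulVec hA up vt
  rw [← hCdef] at hVI
  rw [hclaim1, hvtA] at hVI
  calc um ⬝ᵥ (C *ᵥ um) = 2 * (um ⬝ᵥ v) - v ⬝ᵥ (A *ᵥ v) := by rw [humC, hvAv]; ring
    _ = 2 * (um ⬝ᵥ v) - (2 * (w ⬝ᵥ (A *ᵥ w)) - 2 * (w ⬝ᵥ (A *ᵥ R w))) := by rw [hvA]
    _ ≤ 2 * (um ⬝ᵥ v) - (2 * (w ⬝ᵥ (A *ᵥ w)) + 2 * (w ⬝ᵥ (A *ᵥ R w))) := by linarith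
    _ ≤ up ⬝ᵥ (C *ᵥ up) := hVI


/-- The same with the reflection on the FIRST argument: `0 ≤ Σ_{x,y} u_x A⁻¹(θx, y) u_y`. [cite: GlimmJaffe1987, §7.10 Def. 7.10.2, Thm. 7.10.3] -/
theorem reflectedCovariance_nonneg_of_precision_sites' [DecidableEq V] {A : Matrix V V ℝ} (hA : A.PosDef) {θ : V ≃ V} (hθ : Function.Involutive θ)
    (hθA : ∀ x y, A (θ x) (θ y) = A x y) {P : Set V} (hP : ∀ x, x ∉ P → θ x ∈ P) (hF : ∀ x, x ∈ P → θ x ∈ P → θ x = x)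
    (hcut : ∀ w : V → ℝ, (∀ x, x ∉ P → w x = 0) → (∀ x, θ x = x → w x = 0) → ∑ x, ∑ y, w x * A x (θ y) * w y ≤ 0)
    (u : V → ℝ) (hu : ∀ x, x ∉ P → u x = 0) :
    0 ≤ ∑ x, ∑ y, u x * A⁻¹ (θ x) y * u y := by
  have h := reflectedCovariance_nonneg_of_precision_sites hA hθ hθA hP hF hcut u hu
  refine h.trans_eq (Finset.sum_congr rfl fun x _ => Finset.sum_congr rfl fun y _ => ?_)
  rw [← inv_apply_equiv_of_invariant θ hθA x (θ y), hθ y]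

/-- ★★★ **THE GAUSSIAN FIELD `N(0, A⁻¹)` IS REFLECTION POSITIVE ON ALL BOUNDED HALF-SPACE OBSERVABLES** under the hypotheses of
`reflectedCovariance_nonneg_of_precision_sites` (reflections through OR between sites): the tree's `IsReflectionPositive (gaussianFieldOfKernel A⁻¹) θ P`.
[cite: GlimmJaffe1987, §6.2 Thm. 6.2.2, §7.10 Thm. 7.10.3] [cite: FILS1978, §2, Thm. 2.1] [cite: Biskup2009, §5.1 Def. 5.2, Lemma 5.6] -/
theorem gaussianField_isReflectionPositive_of_precision_sites [DecidableEq V] {A : Matrix V V ℝ} (hA : A.PosDef) (θ : V ≃ V) (hθ : Function.Involutive θ)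
    (hθA : ∀ x y, A (θ x) (θ y) = A x y) {P : Set V} (hP : ∀ x, x ∉ P → θ x ∈ P) (hF : ∀ x, x ∈ P → θ x ∈ P → θ x = x)
    (hcut : ∀ w : V → ℝ, (∀ x, x ∉ P → w x = 0) → (∀ x, θ x = x → w x = 0) → ∑ x, ∑ y, w x * A x (θ y) * w y ≤ 0) :
    IsReflectionPositive (gaussianFieldOfKernel fun i j : V => A⁻¹ i j) θ P :=
  gaussianField_isReflectionPositive_of_vector (isPosSemidefKernel_inv_of_posDef hA) θ (inv_apply_equiv_of_invariant θ hθA) hθ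
    (reflectedCovariance_nonneg_of_precision_sites' hA hθ hθA hP hF hcut)

/-- The real form. [cite: GlimmJaffe1987, §7.10 Thm. 7.10.3] [cite: Biskup2009, §5.1 Def. 5.2] -/
theorem gaussianField_isReflectionPositiveReal_of_precision_sites [DecidableEq V] {A : Matrix V V ℝ} (hA : A.PosDef) (θ : V ≃ V) (hθ : Function.Involutive θ)
    (hθA : ∀ x y, A (θ x) (θ y) = A x y) {P : Set V} (hP : ∀ x, x ∉ P → θ x ∈ P) (hF : ∀ x, x ∈ P → θ x ∈ P → θ x = x)
    (hcut : ∀ w : V → ℝ, (∀ x, x ∉ P → w x = 0) → (∀ x, θ x = x → w x = 0) → ∑ x, ∑ y, w x * A x (θ y) * w y ≤ 0) :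
    IsReflectionPositiveReal (gaussianFieldOfKernel fun i j : V => A⁻¹ i j) θ P :=
  (gaussianField_isReflectionPositive_of_precision_sites hA θ hθ hθA hP hF hcut).real

omit [Fintype V] in
/-- A half SWAPPED with its complement (`θx ∈ P ↔ x ∉ P`, part I) satisfies the hypotheses of this file (no overlap at all). [cite: GlimmJaffe1987, §7.10 Thm. 7.10.3] -/
theorem halves_of_swap {θ : V ≃ V} {P : Set V} (hPswap : ∀ x, θ x ∈ P ↔ x ∉ P) :
    (∀ x, x ∉ P → θ x ∈ P) ∧ (∀ x, x ∈ P → θ x ∈ P → θ x = x) :=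
  ⟨fun x hx => (hPswap x).mpr hx, fun x hx hθx => absurd hx ((hPswap x).mp hθx)⟩

/-- **The no-coupling sufficient condition** (through-site reflections of a nearest-neighbour precision): if `A(x,θy) = 0` for `x ≠ y` in `P ∖ Fix θ` and
`A(x,θx) ≤ 0` on `P ∖ Fix θ`, the cut hypothesis holds. [cite: FILS1978, §2, §3 (nearest-neighbour interactions)] [cite: GlimmJaffe1987, §7.10 Thm. 7.10.3] -/
theorem cut_nonpos_of_noCoupling {A : Matrix V V ℝ} {θ : V ≃ V} {P : Set V}
    (hoff : ∀ x ∈ P, θ x ≠ x → ∀ y ∈ P, θ y ≠ y → x ≠ y → A x (θ y) = 0) (hdiag : ∀ x ∈ P, θ x ≠ x → A x (θ x) ≤ 0)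
    (w : V → ℝ) (hw : ∀ x, x ∉ P → w x = 0) (hwF : ∀ x, θ x = x → w x = 0) :
    ∑ x, ∑ y, w x * A x (θ y) * w y ≤ 0 := by
  classical
  refine cut_nonpos_of_nearestNeighbour (P := {x | x ∈ P ∧ θ x ≠ x}) (fun x hx y hy hxy => hoff x hx.1 hx.2 y hy.1 hy.2 hxy)
    (fun x hx => hdiag x hx.1 hx.2) w fun x hx => ?_
  by_cases hxP : x ∈ P
  · have hfx : θ x = x := by
      by_contra h
      exact hx ⟨hxP, h⟩
    exact hwF x hfx
  · exact hw x hxP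

/-! ### The converse for swapped halves: reflection positivity of the covariance forces a ferromagnetic cut (the criterion of part I is sharp) -/

/-- ★★ **THE PRECISION CRITERION IS AN EQUIVALENCE** (swapped halves): if `A` is positive definite, `θ`-invariant, `θ` swaps `P` with its complement, and the
covariance `A⁻¹` is reflection positive on `P` (`0 ≤ Σ u_x A⁻¹(x,θy) u_y` for `u` supported in `P`), then the cut coupling of `A` is ferromagnetic:
`Σ_{x,y} w_x A(x,θy) w_y ≤ 0` for every `w` supported in `P`.  Proof: apply part I to the sign-twisted covariance `S A⁻¹ S`, `S = diag(𝟙_P − 𝟙_{Pᶜ})` (positive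
definite, `θ`-invariant, with cut `−(A⁻¹)`'s), whose inverse is `S A S`. [cite: GlimmJaffe1987, §7.10 Thm. 7.10.1 (Remark 3: equivalent to `C_D ≤ C_N`)] [cite: FILS1978, Thm. 2.1] -/
theorem precisionCut_nonpos_of_reflectedCovariance_nonneg [DecidableEq V] {A : Matrix V V ℝ} (hA : A.PosDef) {θ : V ≃ V} (hθ : Function.Involutive θ)
    (hθA : ∀ x y, A (θ x) (θ y) = A x y) {P : Set V} (hP : ∀ x, θ x ∈ P ↔ x ∉ P)
    (hRP : ∀ u : V → ℝ, (∀ x, x ∉ P → u x = 0) → 0 ≤ ∑ x, ∑ y, u x * A⁻¹ x (θ y) * u y)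
    (w : V → ℝ) (hw : ∀ x, x ∉ P → w x = 0) :
    ∑ x, ∑ y, w x * A x (θ y) * w y ≤ 0 := by
  classical
  have hdet : IsUnit A.det := (Matrix.isUnit_iff_isUnit_det _).mp hA.isUnit
  -- the sign twist
  let s : V → ℝ := fun x => if x ∈ P then 1 else -1
  have hs : ∀ x, s x = if x ∈ P then 1 else -1 := fun x => rfl
  have hsθ : ∀ x, s (θ x) = -s x := fun x => by
    by_cases hx : x ∈ P
    · have hθx : θ x ∉ P := fun h => ((hP x).mp h) hx
      simp only [hs, hx, if_true, hθx, if_false]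
    · have hθx : θ x ∈ P := (hP x).mpr hx
      simp only [hs, hx, if_false, hθx, if_true, neg_neg]
  have hss : ∀ x, s x * s x = 1 := fun x => by by_cases hx : x ∈ P <;> simp [hs, hx]
  set S : Matrix V V ℝ := Matrix.diagonal s with hSdef
  have hSS : S * S = 1 := by
    rw [hSdef, Matrix.diagonal_mul_diagonal, ← Matrix.diagonal_one]
    congr 1
    funext x
    exact hss x
  have hSt : Sᴴ = S := by rw [hSdef, Matrix.diagonal_conjTranspose]; simp
  have hSinj : Function.Injective S.mulVec := by
    refine Matrix.mulVec_injective_iff_isUnit.mpr ⟨⟨S, S, hSS, hSS⟩, rfl⟩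
  set B : Matrix V V ℝ := S * A⁻¹ * S with hBdef
  have hB : B.PosDef := by
    have h := hA.inv.conjTranspose_mul_mul_same (B := S) hSinj
    rwa [hSt] at h
  have hBapply : ∀ x y, B x y = s x * A⁻¹ x y * s y := fun x y => by
    rw [hBdef, Matrix.mul_diagonal, Matrix.diagonal_mul]
  have hθB : ∀ x y, B (θ x) (θ y) = B x y := fun x y => by
    rw [hBapply, hBapply, inv_apply_equiv_of_invariant θ hθA, hsθ, hsθ]
    ring
  -- the cut of `B` is `−` the reflected covariance form
  have hcutB : ∀ v : V → ℝ, (∀ x, x ∉ P → v x = 0) → ∑ x, ∑ y, v x * B x (θ y) * v y ≤ 0 := by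
    intro v hv
    have hterm : ∀ x y, v x * B x (θ y) * v y = -(v x * A⁻¹ x (θ y) * v y) := by
      intro x y
      rw [hBapply, hsθ]
      by_cases hx : x ∈ P
      · by_cases hy : y ∈ P
        · simp only [hs, hx, hy, if_true]; ring
        · rw [hv y hy]; ring
      · rw [hv x hx]; ring
    simp_rw [hterm, Finset.sum_neg_distrib]
    linarith [hRP v hv]
  -- part I for `B`: its inverse `S A S` is reflection positive
  have hBinv : B⁻¹ = S * A * S := by
    rw [hBdef, Matrix.mul_inv_rev, Matrix.mul_inv_rev, Matrix.nonsing_inv_nonsing_inv _ hdet, Matrix.inv_eq_left_inv hSS, Matrix.mul_assoc]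
  have hpos := reflectedCovariance_nonneg_of_precision hB hθ hθB hP hcutB w hw
  rw [hBinv] at hpos
  have hterm : ∀ x y, w x * (S * A * S) x (θ y) * w y = -(w x * A x (θ y) * w y) := by
    intro x y
    rw [Matrix.mul_diagonal, Matrix.diagonal_mul, hsθ]
    by_cases hx : x ∈ P
    · by_cases hy : y ∈ P
      · simp only [hs, hx, hy, if_true]; ring
      · rw [hw y hy]; ring
    · rw [hw x hx]; ring
  simp_rw [hterm, Finset.sum_neg_distrib] at hpos
  linarith

/-- ★★ **EQUIVALENCE** (Glimm–Jaffe §7.10 Remark 3, lattice form): for `A` positive definite and `θ`-invariant and `θ` swapping `P` with its complement, the covariance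
`A⁻¹` is reflection positive on `P` IFF the cut coupling of the precision `A` across `P | θP` is ferromagnetic. [cite: GlimmJaffe1987, §7.10 Thm. 7.10.1, Remark 3] [cite: FILS1978, Thm. 2.1] -/
theorem reflectedCovariance_nonneg_iff_precisionCut_nonpos [DecidableEq V] {A : Matrix V V ℝ} (hA : A.PosDef) {θ : V ≃ V} (hθ : Function.Involutive θ)
    (hθA : ∀ x y, A (θ x) (θ y) = A x y) {P : Set V} (hP : ∀ x, θ x ∈ P ↔ x ∉ P) :
    (∀ u : V → ℝ, (∀ x, x ∉ P → u x = 0) → 0 ≤ ∑ x, ∑ y, u x * A⁻¹ x (θ y) * u y)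
      ↔ (∀ w : V → ℝ, (∀ x, x ∉ P → w x = 0) → ∑ x, ∑ y, w x * A x (θ y) * w y ≤ 0) :=
  ⟨fun h => precisionCut_nonpos_of_reflectedCovariance_nonneg hA hθ hθA hP h,
    fun h => reflectedCovariance_nonneg_of_precision hA hθ hθA hP h⟩

end PrecisionRPSites

end Literature.Probability.LatticeModels
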